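/-
Copyright (c) 2026 the pub-hodgecm-mathlib formalisation cell (harness21).  Prover seat hodgecm-mathlib-K2Liu-p11 (g3), Track B «K2-LIT»,
#184♮ = hLiu418 = `stmt-HodgeConjecture-24832`; #41 G6-arch (A∞) general `K_w`-type, piece (H2-an) FILE 2: EVERY SIEGEL SECTION WITH A COMPACT PICTURE IN `ℂ[u, D⁻¹]`
IS CONTINUOUS ON `U(J)` AND MAJORISED BY `f⁰_{σ}` (the `hFc ∕ hDc ∕ hFb ∕ hDb` binders of ★ FILE 1 `K2LiuArchIntertwiningDominatedSwap`).
THEOREMS ONLY (no `def`, no `instance`, no notation, no named-fact hypothesis, no `sorry`).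
-/
import Summits.HodgeConjecture.HodgeConjecture.Theorems.K2LiuU22CompactPictureOperatorDictionary   -- ★ FILE 1′ (brings DEFS `Carrier`, `evalAt`, ★ S2-P A `K2LiuU22ShilovCoordinate`)
import Summits.HodgeConjecture.HodgeConjecture.Theorems.K2LiuArchIntertwiningMajorant              -- ★ (L-ii) (`norm_archScalarSection_eq_two`, `continuousAt_archScalarSection`, `continuous_denom`)
import Summits.HodgeConjecture.HodgeConjecture.Theorems.K2LiuArchInducedTubeSection                -- ★ (A∞-0) (`isArchSiegelSection_archScalarSection`)
import Literature.NumberTheory.Automorphic.IwasawaDecompositionArchimedean                          -- ★ `Matrix.isCompact_unitaryGroup`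
import HarnessLib

/-!
# Crux `HLiu418`, G6-arch (A∞), (H2-an) FILE 2: SIEGEL SECTIONS WITH A COMPACT PICTURE IN `𝒜 = ℂ[u, D⁻¹]` — factorisation through `f⁰_{s,k}`,
# continuity on `U(J)`, and the majoration `‖F(h)‖ ≤ C·‖j(h, i1)‖^{−(2σ+2)}`

Cell `hodgecm-mathlib`, crux item hLiu418 = `stmt-HodgeConjecture-24832` (helper lane `--supports`, count-neutral); squad K2 ∕ K2Liu, prover K2Liu-p11 (g3).

DATA: `k : ℤ`, `s : ℂ`, `χ_k(z) = (z̄∕‖z‖)^k`; a Siegel section `F ∈ I_w(s, χ_k)` (★ `IsArchSiegelSection`) with COMPACT PICTURE `Q ∈ 𝒜` (`F(k_v) = ev_v Q` for unitary `v`; ★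
DEFS `evalAt`, ★ S2-P A `k_v`).  Every rung of the `K_w`-type ladder is such an `F` (★ S2-K `fkl`, ★ FILE 1′: the ray derivatives have compact picture `Op_X Q`).
* §1 `exists_aeval_mul_det_inv_pow` (`ev_v Q = P(v)·det(v)^{−n}`), `exists_bound_evalAt_unitary` (`‖ev_v Q‖ ≤ B` on the COMPACT `U(2)`, ★ `Matrix.isCompact_unitaryGroup`);
* §2 `norm_det_eq_one_of_unitary`, `det_shilov_ne_zero`, `archScalarSection_kU` (`f⁰_{s,k}(k_v) = det(v)^{−k}`);
* §3 **`apply_eq_archScalarSection_mul`**: on `U(J)`, **`F(h) = f⁰_{s,k}(h) · det(v_h)^k · ev_{v_h} Q`**, `v_h = D⁻⁻¹D⁺` the Shilov coordinate (★ `apply_eq_mul_apply_kU` for `F` and for `f⁰`);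
* §4 **`norm_apply_le_of_bound`** ∕ **`exists_norm_apply_le`**: `‖F(h)‖ ≤ B·‖j(h, i1)‖^{−(2·re s + 2)}` on `U(J)` (★ `norm_archScalarSection_eq_two`) — binders `hFb`∕`hDb` of ★ FILE 1;
* §5 **`continuousOn_UJ`**: `F` is continuous on `U(J)` (the three factors of §3 are; `ev_v Q = P(v)det(v)^{−n}` is continuous in `v` on `{det ≠ 0}`) — binders `hFc`∕`hDc`.
References: [Knapp1986, Ch. VII §1 (compact picture)]; [Shimura1997, §16.4]; [LeeZhu1998, §5 p. 5032].
HONEST LABEL: HC_CM is proved only modulo the 7 printed citations (2 remaining named inputs: hLiu418 = stmt-HodgeConjecture-24832,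
h413 = stmt-HodgeConjecture-24833) until rung 0 closes; count-neutral helper, closes no socket.
-/

set_option autoImplicit false
set_option linter.dupNamespace false

noncomputable section

open Complex Matrix NormedSpace Topology Filter
open scoped ComplexConjugate

namespace Summit.HodgeConjecture.HodgeConjecture.Cruxes.HLiu418.K2LiuArchKFiniteSectionMajorised

open Literature.NumberTheory.ModularForms.SiegelUpperHalfSpace (num denom num_def denom_def)
open Literature.NumberTheory.Automorphic (Matrix.isCompact_unitaryGroup)
open Summit.HodgeConjecture.HodgeConjecture.Cruxes.HLiu418.K2LiuHermitianTubeCocycle (isUnit_det_denom posDef_im_I_smul_one mul_mem_UJ)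
open Summit.HodgeConjecture.HodgeConjecture.Cruxes.HLiu418.K2LiuArchInducedTubeDefs
open Summit.HodgeConjecture.HodgeConjecture.Cruxes.HLiu418.K2LiuArchInducedTubeSection (isArchSiegelSection_archScalarSection)
open Summit.HodgeConjecture.HodgeConjecture.Cruxes.HLiu418.K2LiuArchIntertwiningMajorant (norm_archScalarSection_eq_two continuousAt_archScalarSection continuous_denom)
open Summit.HodgeConjecture.HodgeConjecture.Cruxes.HLiu418.K2LiuU22ShilovCoordinate
open Summit.HodgeConjecture.HodgeConjecture.Cruxes.HLiu418.K2LiuU22CompactPictureDefs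

/-! ## §1  The compact picture evaluation: explicit form and a bound on `U(2)` -/

/-- **`ev_v Q = P(v) · det(v)^{−n}`** for some polynomial `P` and `n : ℕ` (every element of `𝒜 = ℂ[u, D⁻¹]` is `P·D^{−n}`). [LeeZhu1998, p. 5032] -/
theorem exists_aeval_mul_det_inv_pow (Q : Carrier) :
    ∃ (P : MvPolynomial (Fin 2 × Fin 2) ℂ) (n : ℕ), ∀ (v : Matrix (Fin 2) (Fin 2) ℂ) (hv : v.det ≠ 0),
      evalAt v hv Q = MvPolynomial.aeval (fun kl : Fin 2 × Fin 2 => v kl.1 kl.2) P * (v.det⁻¹) ^ n := by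
  obtain ⟨⟨P, D, n, hn⟩, hP⟩ := IsLocalization.surj (Submonoid.powers detPoly) Q
  simp only at hn hP
  have hP' : Q * uMat.det ^ n = algebraMap (MvPolynomial (Fin 2 × Fin 2) ℂ) Carrier P := by
    rw [det_uMat, ← map_pow, hn]; exact hP
  have ha : Q = algebraMap (MvPolynomial (Fin 2 × Fin 2) ℂ) Carrier P * dInv ^ n := by
    calc Q = Q * (uMat.det ^ n * dInv ^ n) := by rw [← mul_pow, det_uMat_mul_dInv, one_pow, mul_one]
      _ = algebraMap (MvPolynomial (Fin 2 × Fin 2) ℂ) Carrier P * dInv ^ n := by rw [← mul_assoc, hP']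
  refine ⟨P, n, fun v hv => ?_⟩
  rw [ha, map_mul, map_pow, evalAt_algebraMap, evalAt_dInv]

/-- **THE COMPACT PICTURE IS BOUNDED ON `U(2)`**: `∃ B ≥ 0, ∀ v unitary, ‖ev_v Q‖ ≤ B` (`U(2)` is compact, ★ `Matrix.isCompact_unitaryGroup`; `v ↦ P(v)det(v)^{−n}` is
continuous on `{det ≠ 0} ⊇ U(2)`). [Knapp1986, Ch. VII §1] -/
theorem exists_bound_evalAt_unitary (Q : Carrier) :
    ∃ B : ℝ, 0 ≤ B ∧ ∀ (v : Matrix (Fin 2) (Fin 2) ℂ), vᴴ * v = 1 → ∀ hv : v.det ≠ 0, ‖evalAt v hv Q‖ ≤ B := by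
  obtain ⟨P, n, hrep⟩ := exists_aeval_mul_det_inv_pow Q
  have hcont : ContinuousOn (fun v : Matrix (Fin 2) (Fin 2) ℂ => MvPolynomial.aeval (fun kl : Fin 2 × Fin 2 => v kl.1 kl.2) P * (v.det⁻¹) ^ n)
      {v | v.det ≠ 0} := by
    refine ContinuousOn.mul ?_ ((ContinuousOn.inv₀ continuous_id.matrix_det.continuousOn fun v hv => hv).pow n)
    have h1 : Continuous fun v : Matrix (Fin 2) (Fin 2) ℂ => (fun kl : Fin 2 × Fin 2 => v kl.1 kl.2) :=
      continuous_pi fun kl => (continuous_apply kl.2).comp (continuous_apply kl.1)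
    have h2 : Continuous fun x : Fin 2 × Fin 2 → ℂ => MvPolynomial.aeval x P := by
      show Continuous fun x : Fin 2 × Fin 2 → ℂ => MvPolynomial.eval x P
      exact MvPolynomial.continuous_eval P
    exact (h2.comp h1).continuousOn
  have hsub : (Matrix.unitaryGroup (Fin 2) ℂ : Set (Matrix (Fin 2) (Fin 2) ℂ)) ⊆ {v | v.det ≠ 0} := by
    intro v hv h0
    have h := congrArg Matrix.det (Matrix.mem_unitaryGroup_iff'.1 hv)
    rw [det_mul, h0, mul_zero, det_one] at h
    exact zero_ne_one h
  obtain ⟨B, hB⟩ := (Matrix.isCompact_unitaryGroup (ι := Fin 2) (𝕜 := ℂ)).exists_bound_of_continuousOn (hcont.mono hsub)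
  refine ⟨max B 0, le_max_right _ _, fun v hv hv' => ?_⟩
  have hmem : v ∈ (Matrix.unitaryGroup (Fin 2) ℂ : Set (Matrix (Fin 2) (Fin 2) ℂ)) := Matrix.mem_unitaryGroup_iff'.2 hv
  rw [hrep v hv']
  exact (hB v hmem).trans (le_max_left _ _)

/-! ## §2  Unitary determinants; the scalar-type vector on the coset section -/

/-- `‖det v‖ = 1` for `vᴴ v = 1`. [folklore] -/
theorem norm_det_eq_one_of_unitary {l : Type*} [Fintype l] [DecidableEq l] {v : Matrix l l ℂ} (hv : vᴴ * v = 1) : ‖v.det‖ = 1 := by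
  have h := congrArg Matrix.det hv
  rw [det_mul, det_conjTranspose, det_one] at h
  have h2 : ‖v.det‖ * ‖v.det‖ = 1 := by
    have := congrArg norm h
    rwa [norm_mul, norm_star, norm_one] at this
  nlinarith [norm_nonneg v.det]

/-- the Shilov coordinate of `h ∈ U(J)` has non-zero determinant (it is unitary, ★ `conjTranspose_shilov_mul`). [Shimura1997, §6] -/
theorem det_shilov_ne_zero {l : Type*} [Fintype l] [DecidableEq l] {h : Matrix (l ⊕ l) (l ⊕ l) ℂ} (hh : hᴴ * Matrix.J l ℂ * h = Matrix.J l ℂ) :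
    ((denom h (-(I • (1 : Matrix l l ℂ))))⁻¹ * denom h (I • (1 : Matrix l l ℂ))).det ≠ 0 := by
  intro h0
  have h1 := norm_det_eq_one_of_unitary (conjTranspose_shilov_mul hh)
  rw [h0, norm_zero] at h1
  exact zero_ne_one h1

/-- **`f⁰_{s,k}(k_v) = det(v)^{−k}`** for unitary `v` (`denom k_v (i1) = v`, `‖det v‖ = 1`). [Shimura1997, §16.4] -/
theorem archScalarSection_kU (k : ℤ) (s : ℂ) {v : Matrix (Fin 2) (Fin 2) ℂ} (hv : vᴴ * v = 1) :
    archScalarSection k s ((2 : ℂ)⁻¹ • (fromBlocks (1 + v) (-(I • (1 - v))) (I • (1 - v)) (1 + v) : Matrix (Fin 2 ⊕ Fin 2) (Fin 2 ⊕ Fin 2) ℂ)) = v.det ^ (-k) := by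
  rw [archScalarSection_apply, denom_kU_I, norm_det_eq_one_of_unitary hv, Complex.ofReal_one, Complex.one_cpow, mul_one]

/-! ## §3  The factorisation through `f⁰_{s,k}` -/

/-- **`F(h) = f⁰_{s,k}(h) · det(v_h)^k · ev_{v_h} Q` on `U(J)`** (`v_h = D⁻⁻¹D⁺` the Shilov coordinate): ★ `apply_eq_mul_apply_kU` for `F` and for `f⁰_{s,k}` share the multiplier
`χ_k(det p₁₁)‖det p₁₁‖^{2s+2}`, and `f⁰_{s,k}(k_v) = det(v)^{−k}`. [Knapp1986, Ch. VII §1] [Shimura1997, §16.4] -/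
theorem apply_eq_archScalarSection_mul (k : ℤ) (s : ℂ) {F : Matrix (Fin 2 ⊕ Fin 2) (Fin 2 ⊕ Fin 2) ℂ → ℂ}
    (hF : IsArchSiegelSection (fun z : ℂ => (conj z / ((‖z‖ : ℝ) : ℂ)) ^ k) s F) (Q : Carrier)
    (hFQ : ∀ (v : Matrix (Fin 2) (Fin 2) ℂ), vᴴ * v = 1 → ∀ hv : v.det ≠ 0,
      F ((2 : ℂ)⁻¹ • fromBlocks (1 + v) (-(I • (1 - v))) (I • (1 - v)) (1 + v)) = evalAt v hv Q)
    {h : Matrix (Fin 2 ⊕ Fin 2) (Fin 2 ⊕ Fin 2) ℂ} (hh : hᴴ * Matrix.J (Fin 2) ℂ * h = Matrix.J (Fin 2) ℂ) :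
    F h = archScalarSection k s h *
      (((denom h (-(I • (1 : Matrix (Fin 2) (Fin 2) ℂ))))⁻¹ * denom h (I • (1 : Matrix (Fin 2) (Fin 2) ℂ))).det ^ k *
        evalAt ((denom h (-(I • (1 : Matrix (Fin 2) (Fin 2) ℂ))))⁻¹ * denom h (I • (1 : Matrix (Fin 2) (Fin 2) ℂ))) (det_shilov_ne_zero hh) Q) := by
  have hVu := conjTranspose_shilov_mul hh
  have e1 := apply_eq_mul_apply_kU hF hh
  have e2 := apply_eq_mul_apply_kU (isArchSiegelSection_archScalarSection (l := Fin 2) k s) hh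
  rw [hFQ _ hVu (det_shilov_ne_zero hh)] at e1
  rw [archScalarSection_kU k s hVu] at e2
  rw [e1, e2, mul_assoc _ (_ ^ (-k)) (_ ^ k * _), ← mul_assoc (_ ^ (-k)) (_ ^ k) _, zpow_neg_mul_zpow_self _ (det_shilov_ne_zero hh), one_mul]

/-! ## §4  The majoration -/

/-- **`‖F(h)‖ ≤ B · ‖j(h, i1)‖^{−(2·re s + 2)}` on `U(J)`** when the compact picture is bounded by `B` on `U(2)` (§3 + ★ `norm_archScalarSection_eq_two`; `‖det v_h‖ = 1`).
[Shimura1997, §16.4] [Knapp1986, Ch. VII §1] -/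
theorem norm_apply_le_of_bound (k : ℤ) (s : ℂ) {F : Matrix (Fin 2 ⊕ Fin 2) (Fin 2 ⊕ Fin 2) ℂ → ℂ}
    (hF : IsArchSiegelSection (fun z : ℂ => (conj z / ((‖z‖ : ℝ) : ℂ)) ^ k) s F) (Q : Carrier)
    (hFQ : ∀ (v : Matrix (Fin 2) (Fin 2) ℂ), vᴴ * v = 1 → ∀ hv : v.det ≠ 0,
      F ((2 : ℂ)⁻¹ • fromBlocks (1 + v) (-(I • (1 - v))) (I • (1 - v)) (1 + v)) = evalAt v hv Q)
    {B : ℝ} (hB : ∀ (v : Matrix (Fin 2) (Fin 2) ℂ), vᴴ * v = 1 → ∀ hv : v.det ≠ 0, ‖evalAt v hv Q‖ ≤ B)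
    {h : Matrix (Fin 2 ⊕ Fin 2) (Fin 2 ⊕ Fin 2) ℂ} (hh : hᴴ * Matrix.J (Fin 2) ℂ * h = Matrix.J (Fin 2) ℂ) :
    ‖F h‖ ≤ B * ‖(denom h (I • (1 : Matrix (Fin 2) (Fin 2) ℂ))).det‖ ^ (-(2 * s.re + 2)) := by
  have hj : (denom h (I • (1 : Matrix (Fin 2) (Fin 2) ℂ))).det ≠ 0 := (isUnit_det_denom hh posDef_im_I_smul_one).ne_zero
  rw [apply_eq_archScalarSection_mul k s hF Q hFQ hh, norm_mul, norm_mul, norm_zpow, norm_det_eq_one_of_unitary (conjTranspose_shilov_mul hh), _root_.one_zpow, one_mul,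
    norm_archScalarSection_eq_two k s hj, mul_comm]
  exact mul_le_mul_of_nonneg_right (hB _ (conjTranspose_shilov_mul hh) _) (Real.rpow_nonneg (norm_nonneg _) _)

/-- **THE MAJORATION BINDER** (`hFb`∕`hDb` of ★ FILE 1): `∃ C ≥ 0, ∀ h ∈ U(J), ‖F(h)‖ ≤ C · ‖j(h, i1)‖^{−(2·re s + 2)}`. [Shimura1997, §16.4] -/
theorem exists_norm_apply_le (k : ℤ) (s : ℂ) {F : Matrix (Fin 2 ⊕ Fin 2) (Fin 2 ⊕ Fin 2) ℂ → ℂ}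
    (hF : IsArchSiegelSection (fun z : ℂ => (conj z / ((‖z‖ : ℝ) : ℂ)) ^ k) s F) (Q : Carrier)
    (hFQ : ∀ (v : Matrix (Fin 2) (Fin 2) ℂ), vᴴ * v = 1 → ∀ hv : v.det ≠ 0,
      F ((2 : ℂ)⁻¹ • fromBlocks (1 + v) (-(I • (1 - v))) (I • (1 - v)) (1 + v)) = evalAt v hv Q) :
    ∃ C : ℝ, 0 ≤ C ∧ ∀ h : Matrix (Fin 2 ⊕ Fin 2) (Fin 2 ⊕ Fin 2) ℂ, hᴴ * Matrix.J (Fin 2) ℂ * h = Matrix.J (Fin 2) ℂ →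
      ‖F h‖ ≤ C * ‖(denom h (I • (1 : Matrix (Fin 2) (Fin 2) ℂ))).det‖ ^ (-(2 * s.re + 2)) := by
  obtain ⟨B, hB0, hB⟩ := exists_bound_evalAt_unitary Q
  exact ⟨B, hB0, fun h hh => norm_apply_le_of_bound k s hF Q hFQ hB hh⟩

/-! ## §5  Continuity on `U(J)` -/

/-- the Shilov coordinate `h ↦ D⁻⁻¹ D⁺` is continuous at every `h ∈ U(J)` (`det D⁻ ≠ 0` there, ★ `isUnit_det_denom_negI`). [Shimura1997, §6] -/
theorem continuousAt_shilov {h : Matrix (Fin 2 ⊕ Fin 2) (Fin 2 ⊕ Fin 2) ℂ} (hh : hᴴ * Matrix.J (Fin 2) ℂ * h = Matrix.J (Fin 2) ℂ) :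
    ContinuousAt (fun y : Matrix (Fin 2 ⊕ Fin 2) (Fin 2 ⊕ Fin 2) ℂ =>
      (denom y (-(I • (1 : Matrix (Fin 2) (Fin 2) ℂ))))⁻¹ * denom y (I • (1 : Matrix (Fin 2) (Fin 2) ℂ))) h := by
  have hd : Continuous fun y : Matrix (Fin 2 ⊕ Fin 2) (Fin 2 ⊕ Fin 2) ℂ => denom y (-(I • (1 : Matrix (Fin 2) (Fin 2) ℂ))) := continuous_denom _
  have h0 : (denom h (-(I • (1 : Matrix (Fin 2) (Fin 2) ℂ)))).det ≠ 0 := (isUnit_det_denom_negI hh).ne_zero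
  have hinv : ContinuousAt (fun y : Matrix (Fin 2 ⊕ Fin 2) (Fin 2 ⊕ Fin 2) ℂ => (denom y (-(I • (1 : Matrix (Fin 2) (Fin 2) ℂ))))⁻¹) h := by
    have hA := continuousAt_matrix_inv (denom h (-(I • (1 : Matrix (Fin 2) (Fin 2) ℂ)))) (by rw [Ring.inverse_eq_inv']; exact continuousAt_inv₀ h0)
    exact ContinuousAt.comp (g := Inv.inv) hA hd.continuousAt
  exact hinv.mul (continuous_denom _).continuousAt

/-- **`F` IS CONTINUOUS ON `U(J)`** (binders `hFc`∕`hDc` of ★ FILE 1): by §3, on `U(J)` `F = f⁰_{s,k} · det(v)^k · P(v)·det(v)^{−n}` with `v` the Shilov coordinate — each factor is continuous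
at every `h ∈ U(J)` (★ `continuousAt_archScalarSection`; `det v_h ≠ 0`). [Knapp1986, Ch. VII §1] [Shimura1997, §16.4] -/
theorem continuousOn_UJ (k : ℤ) (s : ℂ) {F : Matrix (Fin 2 ⊕ Fin 2) (Fin 2 ⊕ Fin 2) ℂ → ℂ}
    (hF : IsArchSiegelSection (fun z : ℂ => (conj z / ((‖z‖ : ℝ) : ℂ)) ^ k) s F) (Q : Carrier)
    (hFQ : ∀ (v : Matrix (Fin 2) (Fin 2) ℂ), vᴴ * v = 1 → ∀ hv : v.det ≠ 0,
      F ((2 : ℂ)⁻¹ • fromBlocks (1 + v) (-(I • (1 - v))) (I • (1 - v)) (1 + v)) = evalAt v hv Q) :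
    ContinuousOn F {h : Matrix (Fin 2 ⊕ Fin 2) (Fin 2 ⊕ Fin 2) ℂ | hᴴ * Matrix.J (Fin 2) ℂ * h = Matrix.J (Fin 2) ℂ} := by
  obtain ⟨P, n, hrep⟩ := exists_aeval_mul_det_inv_pow Q
  -- the Shilov coordinate as a map
  obtain ⟨V, hV⟩ : ∃ V : Matrix (Fin 2 ⊕ Fin 2) (Fin 2 ⊕ Fin 2) ℂ → Matrix (Fin 2) (Fin 2) ℂ,
      V = fun y => (denom y (-(I • (1 : Matrix (Fin 2) (Fin 2) ℂ))))⁻¹ * denom y (I • (1 : Matrix (Fin 2) (Fin 2) ℂ)) := ⟨_, rfl⟩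
  -- the explicit continuous model of `F` on `U(J)`
  have hmodel : ∀ y : Matrix (Fin 2 ⊕ Fin 2) (Fin 2 ⊕ Fin 2) ℂ, yᴴ * Matrix.J (Fin 2) ℂ * y = Matrix.J (Fin 2) ℂ →
      F y = archScalarSection k s y * ((V y).det ^ k * (MvPolynomial.aeval (fun kl : Fin 2 × Fin 2 => V y kl.1 kl.2) P * ((V y).det⁻¹) ^ n)) := by
    intro y hy
    simp only [hV]
    rw [apply_eq_archScalarSection_mul k s hF Q hFQ hy, hrep]
  intro h hh
  have hj : (denom h (I • (1 : Matrix (Fin 2) (Fin 2) ℂ))).det ≠ 0 := (isUnit_det_denom hh posDef_im_I_smul_one).ne_zero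
  have hv0 : (V h).det ≠ 0 := by simp only [hV]; exact det_shilov_ne_zero hh
  have hVc : ContinuousAt V h := by rw [hV]; exact continuousAt_shilov hh
  have hdetV : ContinuousAt (fun y => (V y).det) h :=
    (continuous_id.matrix_det : Continuous fun M : Matrix (Fin 2) (Fin 2) ℂ => M.det).continuousAt.comp hVc
  have h1 : Continuous fun v : Matrix (Fin 2) (Fin 2) ℂ => (fun kl : Fin 2 × Fin 2 => v kl.1 kl.2) :=
    continuous_pi fun kl => (continuous_apply kl.2).comp (continuous_apply kl.1)
  have h2 : Continuous fun x : Fin 2 × Fin 2 → ℂ => MvPolynomial.aeval x P := by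
    show Continuous fun x : Fin 2 × Fin 2 → ℂ => MvPolynomial.eval x P
    exact MvPolynomial.continuous_eval P
  have hmodelc : ContinuousAt (fun y : Matrix (Fin 2 ⊕ Fin 2) (Fin 2 ⊕ Fin 2) ℂ =>
      archScalarSection k s y * ((V y).det ^ k * (MvPolynomial.aeval (fun kl : Fin 2 × Fin 2 => V y kl.1 kl.2) P * ((V y).det⁻¹) ^ n))) h :=
    (continuousAt_archScalarSection k s hj).mul ((hdetV.zpow₀ k (Or.inl hv0)).mul
      ((((h2.comp h1).continuousAt).comp hVc).mul ((hdetV.inv₀ hv0).pow n)))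
  exact hmodelc.continuousWithinAt.congr (fun y hy => hmodel y hy) (hmodel h hh)

end Summit.HodgeConjecture.HodgeConjecture.Cruxes.HLiu418.K2LiuArchKFiniteSectionMajorised

end
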